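import Summits.ResolutionOfSingularities.ResolutionOfSingularities.Theses.HomologicalConductor
import Summits.ResolutionOfSingularities.ResolutionOfSingularities.Theorems.NoZeno.Negative.SurfaceKernelHabitat
import Summits.ResolutionOfSingularities.ResolutionOfSingularities.Theorems.NoZeno.Negative.SurfaceKernelNoRegularStage
import Summits.ResolutionOfSingularities.ResolutionOfSingularities.Theorems.SyzygyFlatteningHigherRankTerminationResidueTrdegCases

/-!
# Crux `NoZeno` (stmt-ResolutionOfSingularities-16483) — the surface kernel is ZERO-DIMENSIONAL
# (`hzero` is redundant); kernel-form habitat alternative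

Route `ResolutionOfSingularities/HomologicalConductor`, crux
`Summit.ResolutionOfSingularities.ResolutionOfSingularities.Theses.HomologicalConductor.NoZeno`,
line `birth`, stubs `stub_kernelRankOneSurface` (v6) / `stub_sandwichedTermination` (v7). Negative
lane (`--supports` the crux item): hypothesis-mutation lemmas, no Theses decl is asserted; OURS
(res-L0-w44-tri-1, BARRIER & DEFECT triage).

Under the kernel hypothesis `hker` on a surface (`tr.deg_k K = 2`): `O` is not noetherian
(`not_isNoetherianRing_of_hker`), so `O ≠ K` (`ne_top_of_not_isNoetherianRing`), so by
`surfaceKernel_habitat_datum` the residue field is algebraic over `k`, which is the stubs' binder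
`hzero` verbatim (`surfaceKernel_dimZero`, via the tree's `SyzygyFlattening.residueTrdeg_cases_dimZero`);
and the habitat alternative holds with no side condition (`surfaceKernel_habitat_of_hker`):
ABHYANKAR (`ratRank 2`, defect `0`, value group f.g.) or DEFECT (`ratRank 1`, transcendence defect `1`).
Record for the lead: in the v6/v7 surface stubs BOTH `hexh` (`surfaceKernel_exhausts`) and `hzero`
(this file) are consequences of `hker ∧ tr.deg = 2` and may be dropped.

Kernel-only (axioms `propext`, `Classical.choice`, `Quot.sound`); no `def`, no named fact.
-/

set_option linter.dupNamespace false

noncomputable section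

namespace Summit.ResolutionOfSingularities.ResolutionOfSingularities.Theorems.NoZeno.Negative

open Summit.ResolutionOfSingularities.ResolutionOfSingularities.Theorems.NoZeno.Birth
open Summit.ResolutionOfSingularities.ResolutionOfSingularities.Theorems
open Literature.AlgebraicGeometry.Resolution

variable {k K : Type} [Field k] [Field K] [Algebra k K]

/-- The whole field, as a valuation ring, is noetherian. [folklore] -/
theorem isNoetherianRing_valuationSubring_top : IsNoetherianRing ↥(⊤ : ValuationSubring K) :=
  isNoetherianRing_of_ringEquiv K (Subring.topEquiv (R := K)).symm

/-- A non-noetherian valuation ring is not the whole field. [folklore] -/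
theorem ne_top_of_not_isNoetherianRing (O : ValuationSubring K) (hN : ¬ IsNoetherianRing ↥O) :
    O ≠ ⊤ := by
  rintro rfl
  exact hN isNoetherianRing_valuationSubring_top

/-- **A zero-dimensional valuation ring in the route's binder form.** `residueTrdeg = 0` (residue
field algebraic over `k`) gives the `hzero` binder of the line's stubs verbatim
(`SyzygyFlattening.DimZero`). [folklore] -/
theorem dimZero_of_residueTrdeg_eq_zero (O : ValuationSubring K) (hk : ∀ c : k, algebraMap k K c ∈ O)
    (h0 : residueTrdeg k O hk = 0) :
    ∀ y : K, y ∈ O → ∃ f : Polynomial k, f ≠ 0 ∧ O.valuation (Polynomial.aeval y f) < 1 := by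
  letI : Algebra k O := algebraOfMem k O hk
  haveI : IsScalarTower k O K := isScalarTower_algebraOfMem k O hk
  rw [residueTrdeg_eq O hk] at h0
  haveI : Algebra.IsAlgebraic k (IsLocalRing.ResidueField O) := trdeg_eq_zero_iff.mp h0
  exact SyzygyFlattening.residueTrdeg_cases_dimZero O

/-- **SURFACE KERNEL ⇒ ZERO-DIMENSIONAL** (the stubs' binder `hzero` is REDUNDANT given `hker` and
`tr.deg = 2`): under the kernel hypothesis `hker` on a surface, `O` is not noetherian, hence
(`surfaceKernel_habitat`) `residueTrdeg = 0`, hence every `y ∈ O` is, modulo `𝔪_O`, a root of a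
non-zero `k`-polynomial. Hypothesis-mutation record for the lead: `hzero` (like `hexh`,
`surfaceKernel_exhausts`) may be dropped from `stub_kernelRankOneSurface` /
`stub_sandwichedTermination`. [folklore] -/
theorem surfaceKernel_dimZero (O : ValuationSubring K) (A : Subalgebra k K)
    (hk : ∀ c : k, algebraMap k K c ∈ O) (hA : A.FG) (hfr : IsFractionRing ↥A K)
    (hAO : A.toSubring ≤ O.toSubring)
    (hker : ∀ O' : ValuationSubring K,
      (∀ m : ℕ, ∀ s ∈ tower O A m, s ∈ O' ∧ (s⁻¹ ∈ O' → s⁻¹ ∈ O)) → ¬ IsNoetherianRing ↥O')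
    (htr : Algebra.trdeg k K = 2) :
    ∀ y : K, y ∈ O → ∃ f : Polynomial k, f ≠ 0 ∧ O.valuation (Polynomial.aeval y f) < 1 := by
  have hN := not_isNoetherianRing_of_hker O A hk hA hfr hAO hker
  exact dimZero_of_residueTrdeg_eq_zero O hk
    (surfaceKernel_habitat_datum O A hk hA hfr (ne_top_of_not_isNoetherianRing O hN) hN htr).1

/-- **SURFACE KERNEL ⇒ the habitat alternative, kernel form** (binders of the stubs: no `O ≠ ⊤`,
no non-noetherianity assumed — both follow from `hker`). [folklore] -/
theorem surfaceKernel_habitat_of_hker (O : ValuationSubring K) (A : Subalgebra k K)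
    (hk : ∀ c : k, algebraMap k K c ∈ O) (hA : A.FG) (hfr : IsFractionRing ↥A K)
    (hAO : A.toSubring ≤ O.toSubring)
    (hker : ∀ O' : ValuationSubring K,
      (∀ m : ℕ, ∀ s ∈ tower O A m, s ∈ O' ∧ (s⁻¹ ∈ O' → s⁻¹ ∈ O)) → ¬ IsNoetherianRing ↥O')
    (htr : Algebra.trdeg k K = 2) :
    residueTrdeg k O hk = 0 ∧
      ((ratRank O = 2 ∧ transcendenceDefect k O hk = 0 ∧
          Group.FG (ValuationSubring.ValueGroup O)ˣ) ∨
        (ratRank O = 1 ∧ transcendenceDefect k O hk = 1)) :=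
  have hN := not_isNoetherianRing_of_hker O A hk hA hfr hAO hker
  surfaceKernel_habitat_datum O A hk hA hfr (ne_top_of_not_isNoetherianRing O hN) hN htr

end Summit.ResolutionOfSingularities.ResolutionOfSingularities.Theorems.NoZeno.Negative

end
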